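import Mathlib
import Summits.Ventures.PercRepro2.Defs
import Summits.Ventures.PercRepro2.Independence
import Summits.Ventures.PercRepro2.Graph
import Summits.Ventures.PercRepro2.Induced
import Summits.Ventures.PercRepro2.HullDefs
import Summits.Ventures.PercRepro2.HullFlip
import Summits.Ventures.PercRepro2.HullTheoremA
import Summits.Ventures.PercRepro2.HullCount
import Summits.Ventures.PercRepro2.HullDom
import Summits.Ventures.PercRepro2.HullPieceFlip
import Summits.Ventures.PercRepro2.LocRows

/-!
# The local injection of row 2′LOC gives row 2′DOM on the free fibre (blind cell PercRepro2, p1 g7;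
lead g11 CONJECTURES v2.99f row 2′LOC, ADDENDUM 25 (44); mine-2 g9 `MINE2-PIECEFLIP.md` §3)

`(LOC0)` (`LocRows.Loc0`) is the `b`-free, `P_o`-local injection
`M₀ = {h ∉ H_l, o ∈ B_side} → P₀ = {h ∉ H_l, o ∈ R_side}` that recolours only edges touching the
piece of `o`. Because a blue path from `h ∉ H_l` never meets `C_B(l) ⊇ P_o`, every such recolouring
keeps the whole blue cluster of `h` (`conn_blue_of_eqOn_off_piece`), so the injection carries
`{C_B(h) ∈ 𝒰}` into `{C_B(h) ∈ 𝒰}` for every up-set `𝒰`. On the free fibre the domination sum of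
row 2′DOM is `#(P₀ ∩ {C_B(h) ∈ 𝒰}) − #(M₀ ∩ {C_B(h) ∈ 𝒰})` (the core terms carry sign `0`), hence:

* `domSumG_univ_eq_card_sub_card`: the free-fibre domination sum as a difference of two counts
  (`tgt0`/`src0` of `LocRows` filtered by `C_B(h) ∈ 𝒰`; no new definitions);
* `card_src0_filter_le_of_loc0`: the counting inequality from the injection;
* **`domSumG_univ_nonneg_of_loc0`**: `(LOC0) ⟹` row 2′DOM on the free fibre, for every up-set;
* `domFunG_univ_nonneg_of_loc0` (increasing functionals) and `hullSumG_univ_nonneg_of_loc0`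
  (the (BASE) instance `𝒰 = {S ∣ b ∈ S}`, i.e. the free-fibre hull sum of `HullCount`).

So the chain 2′LOC ⟹ 2′DOM ⟹ 2′HULL (i) = (BASE) is formal on the free fibre; together with
`HullDom.crossCount_of_domRow` a proof of `Loc0` on every graph closes (BASE) on every minor
(every typed fibre is the free fibre of a contraction/deletion minor).
-/

namespace Summit.Ventures.PercRepro2

namespace Hull

open scoped Classical

variable {V : Type*} {E : Type*} [Fintype E] [DecidableEq E]
  {R : Type*} [Field R] [LinearOrder R] [IsStrictOrderedRing R]

variable (ends : E → Sym2 V)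

/-! ## The free-fibre domination sum as a difference of counts -/

/-- Membership in `P₀ ∩ {C_B(h) ∈ 𝒰}` (the filter of `LocRows.tgt0`). -/
lemma mem_tgt0In {l h o : V} {𝒰 : Set (Set V)} {ζ : Config E} :
    ζ ∈ ((LocRows.tgt0 ends l h o).filter fun ζ => cluster ends (blue ζ) h ∈ 𝒰) ↔
      (h ∉ hull ends ζ l ∧ o ∈ rside ends ζ l) ∧ cluster ends (blue ζ) h ∈ 𝒰 := by
  simp [LocRows.tgt0]

/-- Membership in `M₀ ∩ {C_B(h) ∈ 𝒰}` (the filter of `LocRows.src0`). -/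
lemma mem_src0In {l h o : V} {𝒰 : Set (Set V)} {ζ : Config E} :
    ζ ∈ ((LocRows.src0 ends l h o).filter fun ζ => cluster ends (blue ζ) h ∈ 𝒰) ↔
      (h ∉ hull ends ζ l ∧ o ∈ bside ends ζ l) ∧ cluster ends (blue ζ) h ∈ 𝒰 := by
  simp [LocRows.src0]

omit [LinearOrder R] [IsStrictOrderedRing R] in
/-- One term of the free-fibre domination sum is `1[ζ ∈ P₀, C_B(h) ∈ 𝒰] − 1[ζ ∈ M₀, C_B(h) ∈ 𝒰]`. -/
lemma domTerm_eq (l h o : V) (𝒰 : Set (Set V)) (ζ : Config E) :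
    sideSign R ends ζ l o * (if h ∉ hull ends ζ l then 1 else 0) *
        (if cluster ends (blue ζ) h ∈ 𝒰 then (1 : R) else 0) =
      (if ζ ∈ ((LocRows.tgt0 ends l h o).filter fun ζ => cluster ends (blue ζ) h ∈ 𝒰) then 1 else 0) -
        (if ζ ∈ ((LocRows.src0 ends l h o).filter fun ζ => cluster ends (blue ζ) h ∈ 𝒰) then 1
          else 0) := by
  unfold sideSign
  by_cases hh : h ∉ hull ends ζ l
  · by_cases hU : cluster ends (blue ζ) h ∈ 𝒰
    · by_cases hr : o ∈ rside ends ζ l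
      · have hb : o ∉ bside ends ζ l := fun hb => rside_disjoint_bside ζ l o hr hb
        have h1 :
            ζ ∈ ((LocRows.tgt0 ends l h o).filter fun ζ => cluster ends (blue ζ) h ∈ 𝒰) :=
          (mem_tgt0In ends).2 ⟨⟨hh, hr⟩, hU⟩
        have h2 :
            ζ ∉ ((LocRows.src0 ends l h o).filter fun ζ => cluster ends (blue ζ) h ∈ 𝒰) :=
          fun h => hb ((mem_src0In ends).1 h).1.2
        simp [hh, hU, hr, hb, h1, h2]
      · by_cases hb : o ∈ bside ends ζ l
        · have h1 :
              ζ ∉ ((LocRows.tgt0 ends l h o).filter fun ζ => cluster ends (blue ζ) h ∈ 𝒰) :=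
            fun h => hr ((mem_tgt0In ends).1 h).1.2
          have h2 :
              ζ ∈ ((LocRows.src0 ends l h o).filter fun ζ => cluster ends (blue ζ) h ∈ 𝒰) :=
            (mem_src0In ends).2 ⟨⟨hh, hb⟩, hU⟩
          simp [hh, hU, hr, hb, h1, h2]
        · have h1 :
              ζ ∉ ((LocRows.tgt0 ends l h o).filter fun ζ => cluster ends (blue ζ) h ∈ 𝒰) :=
            fun h => hr ((mem_tgt0In ends).1 h).1.2
          have h2 :
            ζ ∉ ((LocRows.src0 ends l h o).filter fun ζ => cluster ends (blue ζ) h ∈ 𝒰) :=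
            fun h => hb ((mem_src0In ends).1 h).1.2
          simp [hh, hU, hr, hb, h1, h2]
    · have h1 :
          ζ ∉ ((LocRows.tgt0 ends l h o).filter fun ζ => cluster ends (blue ζ) h ∈ 𝒰) :=
        fun h => hU ((mem_tgt0In ends).1 h).2
      have h2 :
          ζ ∉ ((LocRows.src0 ends l h o).filter fun ζ => cluster ends (blue ζ) h ∈ 𝒰) :=
        fun h => hU ((mem_src0In ends).1 h).2
      simp [hU, h1, h2]
  · have h1 :
        ζ ∉ ((LocRows.tgt0 ends l h o).filter fun ζ => cluster ends (blue ζ) h ∈ 𝒰) :=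
      fun h => hh ((mem_tgt0In ends).1 h).1.1
    have h2 :
        ζ ∉ ((LocRows.src0 ends l h o).filter fun ζ => cluster ends (blue ζ) h ∈ 𝒰) :=
      fun h => hh ((mem_src0In ends).1 h).1.1
    simp [hh, h1, h2]

omit [LinearOrder R] [IsStrictOrderedRing R] in
/-- **The free-fibre domination sum is `#(P₀ ∩ {C_B(h) ∈ 𝒰}) − #(M₀ ∩ {C_B(h) ∈ 𝒰})`.** -/
theorem domSumG_univ_eq_card_sub_card (z : Config E) (l o h : V) (𝒰 : Set (Set V)) :
    domSumG R ends Finset.univ z l o h 𝒰 =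
      ((((LocRows.tgt0 ends l h o).filter fun ζ => cluster ends (blue ζ) h ∈ 𝒰)).card : R) -
        ((((LocRows.src0 ends l h o).filter fun ζ => cluster ends (blue ζ) h ∈ 𝒰)).card : R) := by
  unfold domSumG
  rw [domFunG_univ]
  simp_rw [domTerm_eq ends l h o 𝒰]
  rw [Finset.sum_sub_distrib, Finset.sum_boole, Finset.sum_boole,
    Finset.filter_mem_eq_inter, Finset.filter_mem_eq_inter, Finset.univ_inter, Finset.univ_inter]

/-! ## The injection carries `{C_B(h) ∈ 𝒰}` into itself -/

omit [Fintype E] [DecidableEq E] in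
/-- A `P_o`-local recolouring of a configuration with `h ∉ H_l`, `o ∈ B_side` can only ENLARGE the
blue cluster of `h`. -/
lemma cluster_blue_subset_of_localAtSet {l h o : V} {ζ ω : Config E}
    (hh : h ∉ hull ends ζ l) (ho : o ∈ bside ends ζ l)
    (hloc : LocRows.LocalAtSet ends (fun ζ => piece ends ζ l o) ζ ω) :
    cluster ends (blue ζ) h ⊆ cluster ends (blue ω) h := by
  intro u hu
  rw [mem_cluster] at hu ⊢
  refine conn_blue_of_eqOn_off_piece ho hh ?_ hu
  intro e he
  have : ω e = ζ e := by
    by_contra hne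
    exact he (hloc e hne)
  simp [blue_apply, this]

/-- **The counting inequality**: under `(LOC0)`, `#(M₀ ∩ {C_B(h) ∈ 𝒰}) ≤ #(P₀ ∩ {C_B(h) ∈ 𝒰})` for
every up-set `𝒰`. -/
theorem card_src0In_le_of_loc0 {l h o : V} (hl : LocRows.Loc0 ends l h o) {𝒰 : Set (Set V)}
    (h𝒰 : IsUpperSet 𝒰) :
    (((LocRows.src0 ends l h o).filter fun ζ => cluster ends (blue ζ) h ∈ 𝒰)).card ≤
      (((LocRows.tgt0 ends l h o).filter fun ζ => cluster ends (blue ζ) h ∈ 𝒰)).card := by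
  obtain ⟨f, hf, hmem⟩ := hl
  let F : Config E → Config E := fun ζ =>
    if hζ : ζ ∈ LocRows.src0 ends l h o then f ⟨ζ, hζ⟩ else ζ
  refine Finset.card_le_card_of_injOn F ?_ ?_
  · intro ζ hζ
    have hζ' := (mem_src0In ends).1 hζ
    have hs : ζ ∈ LocRows.src0 ends l h o := by
      simp [LocRows.src0, hζ'.1.1, hζ'.1.2]
    have hF : F ζ = f ⟨ζ, hs⟩ := by simp [F, hs]
    rw [hF]
    obtain ⟨ht, hloc⟩ := hmem ⟨ζ, hs⟩
    have ht' : h ∉ hull ends (f ⟨ζ, hs⟩) l ∧ o ∈ rside ends (f ⟨ζ, hs⟩) l := by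
      simpa [LocRows.tgt0] using ht
    refine (mem_tgt0In ends).2 ⟨ht', h𝒰 ?_ hζ'.2⟩
    exact cluster_blue_subset_of_localAtSet ends hζ'.1.1 hζ'.1.2 hloc
  · intro ζ₁ hζ₁ ζ₂ hζ₂ hF
    have h1 := (mem_src0In ends).1 (Finset.mem_coe.1 hζ₁)
    have h2 := (mem_src0In ends).1 (Finset.mem_coe.1 hζ₂)
    have hs1 : ζ₁ ∈ LocRows.src0 ends l h o := by simp [LocRows.src0, h1.1.1, h1.1.2]
    have hs2 : ζ₂ ∈ LocRows.src0 ends l h o := by simp [LocRows.src0, h2.1.1, h2.1.2]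
    have hF1 : F ζ₁ = f ⟨ζ₁, hs1⟩ := by simp [F, hs1]
    have hF2 : F ζ₂ = f ⟨ζ₂, hs2⟩ := by simp [F, hs2]
    rw [hF1, hF2] at hF
    have := hf hF
    exact congrArg Subtype.val this

/-! ## Row 2′DOM on the free fibre -/

/-- **`(LOC0)` gives row 2′DOM on the free fibre**: for every up-set `𝒰` of vertex sets,
`Σ_ζ s_{o,l}(ζ) · 1[h ∉ H_l] · 1[C_B(h) ∈ 𝒰] ≥ 0`. -/
theorem domSumG_univ_nonneg_of_loc0 {l h o : V} (hl : LocRows.Loc0 ends l h o) (z : Config E)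
    {𝒰 : Set (Set V)} (h𝒰 : IsUpperSet 𝒰) :
    0 ≤ domSumG R ends Finset.univ z l o h 𝒰 := by
  rw [domSumG_univ_eq_card_sub_card, sub_nonneg]
  exact_mod_cast card_src0In_le_of_loc0 ends hl h𝒰

/-- **`(LOC0)` gives the increasing-functional form of row 2′DOM on the free fibre** (for monotone
`f` on a finite vertex type; layer cake + the colour swap, as in `HullDom`). -/
theorem domFunG_univ_nonneg_of_loc0 [Fintype V] {l h o : V} (hl : LocRows.Loc0 ends l h o)
    (z : Config E) (f : Set V → R) (hf : Monotone f) :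
    0 ≤ domFunG R ends Finset.univ z l o h f := by
  have hsplit : domFunG R ends Finset.univ z l o h f =
      domFunG R ends Finset.univ z l o h (fun S => f S - f ∅) +
        domFunG R ends Finset.univ z l o h (fun _ => f ∅) := by
    rw [← domFunG_add]
    congr 1
    funext S
    ring
  rw [hsplit, domFunG_const, add_zero]
  refine Lambda.nonneg_of_upperSet_indicators (domFunG R ends Finset.univ z l o h)
    (domFunG_add ends Finset.univ z l o h) (domFunG_smul ends Finset.univ z l o h)
    (fun 𝒰 h𝒰 => by
      rw [← domSumG_eq_indicator]
      exact domSumG_univ_nonneg_of_loc0 ends hl z h𝒰) _ _ ?_ ?_ rfl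
  · intro S T hST
    exact sub_le_sub_right (hf hST) _
  · intro S
    exact sub_nonneg.2 (hf (Set.empty_subset S))

/-- **`(LOC0)` gives the (BASE) instance on the free fibre**: the hull sum of `HullCount` at
`G = univ` (`𝒰 = {S ∣ b ∈ S}`) is nonnegative for every `b`. -/
theorem hullSumG_univ_nonneg_of_loc0 {l h o : V} (hl : LocRows.Loc0 ends l h o) (z : Config E)
    (b : V) : 0 ≤ hullSumG R ends Finset.univ z l o h b := by
  rw [hullSumG_eq_domSumG]
  exact domSumG_univ_nonneg_of_loc0 ends hl z (isUpperSet_mem b)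

end Hull

end Summit.Ventures.PercRepro2
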